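import Summits.HubbardSuperconductivity.HubbardSuperconductivity.Theorems.AnisotropyChordTransferFibre3WindowRate
import Summits.HubbardSuperconductivity.HubbardSuperconductivity.Theorems.AnisotropyChordTransferFibre3TwoHoleBSNear
import Summits.HubbardSuperconductivity.HubbardSuperconductivity.Theorems.AnisotropyChordTransferFibre3CapacityLamH

/-!
# Route `AnisotropyChord` / H0 rotor rung: the NEAR-PAIR HOLE₂ TAIL with every analytic input PROVED AND SHARP — capacity slope `1/π`, periodisation `O(1/L²)`, skeleton in `ℚ(1/π)`

Sharpening of p2 g2's capstones `…Fibre3TwoHoleBSNear.dualCert_threeQuarter_near` / `…TwoHoleBSNearSharp.dualCert_threeQuarter_near_sharp`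
(near pair `(z, z + d)`, `|d|∞ ≤ 3`): there the capacity parameter must satisfy `Λup ≥ 4H_{⌊L/2⌋}` (slope `4` vs the true `1/π`) and
the periodisation error is `4C₀ρmax/L` (`C₀ ≈ 221`) resp. `3(8K₂(1 + ln 2 + ln L) + 3π²)ρmax/(4L²)` (`K₂ ≈ 6.4·10³`).  With this
generation's inputs:
* `Subsample.window_canon`, ★ `Subsample.abs_aKer_sub_aZ2_window`: **`|a_L(v;0) − a_∞(v)| ≤ 861/L²` for every `|v|∞ ≤ 5`**, `L ≥ 12`
  (the table of `…Fibre3WindowRate` — exact axis value, sharp diagonal rate, torus harmonicity — under the torus/ℤ² symmetries);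
* ★★★ `TwoHoleBS.dualCert_threeQuarter_near_window` (`12 ≤ L`, `|d₁|, |d₂| ≤ 3`): `DualCert L (¾ε₁) z (z + d)` from invertibility of the
  explicit skeleton `skelA d` (entries `2·aZ2`, now closed forms in `ℚ(1/π)` by `…DiagonalValues`/`…ZSquareWindow`), ANY capacity parameter
  **`Λup ≥ H_{⌊L/2⌋}/π + 1.52`** (`…CapacityLamH.two_Gres_lamH_zero_le_sharp`) with `Λup·s ≠ 1`, and the margin inequality with the error
  coefficient **`ε♯(L,d) = [2ρmax(d)(11.71 ln L + 5.9) + 1722]/L²`** (shell majorant PROVED by p2 g0 + the window periodisation table) —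
  every analytic input of the near-pair tail is now a tree theorem with the right order in `L`; what remains per class is finite
  algebra on `skelA d` as a function of the one parameter `Λup`.  NUMERICS (prover's folder, exact window values): for the four
  disjoint-slot classes `d = (2,1), (2,2), (3,0), (3,1)` the infinite-capacity map `twoHolePinf (skelA d)` is SINGULAR (least
  eigenvalue `0`, next `≈ .55`) and `λ_min(twoHoleP (skelA d) Λ) ≈ 0.134/Λ` (`κ_ζ = 1/|B| = 1/8`), so the margin must keep the
  rank-one capacity term (thresholds of the shape `ε(L,d)·N² ≤ c/Λup(L)`, not `ε ≤ ε₀` against `P∞`); with `ε♯` and `Λup` of this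
  file the inequality first holds near `L ≈ 5·10³` (the PROVED shell term `2ρmax(11.71 ln L + 5.9)/L²` — a true effect, the λ-part
  of the kernel — dominates `ε♯`); `skelA d` is singular for `d = (1,0), (1,1), (2,0)` (coincident slots).
Prover seat `hubbard-h0-rotor-p1` g25; helper for stmt-HubbardSuperconductivity-19089 (`--supports`).
WHAT THIS IS NOT: nothing here proves superconductivity in the Hubbard model (rotor TARGET as worded stays FALSE, g15); a conditional
certificate for ONE family of pairs (near, large `L`) of ONE input (HOLE₂) of ONE conditional reduction (rung 19089); far pairs,
`L < L₀(d)` and the skeleton margins remain.  Mathlib + tree imports only; no sorry, no axioms.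
-/

set_option linter.dupNamespace false
set_option autoImplicit false

noncomputable section

open scoped BigOperators
open Complex

namespace Summit.HubbardSuperconductivity.HubbardSuperconductivity.Theorems.AnisotropyChord.Transfer.Fibre3

namespace Subsample

variable (L : ℕ) [NeZero L]

/-- mirror symmetry in the first coordinate at integer points. [folklore] -/
theorem aKer_int_mirror_x (lam2 : ℝ) (x y : ℤ) :
    aKer L lam2 ((((-x : ℤ)) : ZMod L), ((y : ℤ) : ZMod L)) = aKer L lam2 (((x : ℤ) : ZMod L), ((y : ℤ) : ZMod L)) := by
  unfold aKer
  have e2 : ((((-x : ℤ) : ZMod L), ((y : ℤ) : ZMod L)) : Tor L)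
      = (-((((x : ℤ) : ZMod L), ((y : ℤ) : ZMod L)) : Tor L).1, ((((x : ℤ) : ZMod L), ((y : ℤ) : ZMod L)) : Tor L).2) := by
    push_cast; rfl
  rw [e2, Gres_mirror]

/-- the window table on its canonical domain `0 ≤ y ≤ x ≤ 5`, weakened to the uniform constant `861`. [folklore] -/
theorem window_canon (hL : 12 ≤ L) (x y : ℕ) (hyx : y ≤ x) (hx : x ≤ 5) :
    |aKer L 0 ((((x : ℤ)) : ZMod L), (((y : ℤ)) : ZMod L)) - aZ2 x y| ≤ 861 / (L : ℝ) ^ 2 := by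
  have hL0 : (0 : ℝ) < L := by exact_mod_cast (show 0 < L by omega)
  interval_cases x <;> interval_cases y
  · have h := dev_zero L
    push_cast at h ⊢
    exact h.trans (div_le_div_of_nonneg_right (show (0 : ℝ) ≤ 861 by norm_num) (by positivity))
  · have h := dev_one_zero L (by omega)
    push_cast at h ⊢
    exact h.trans (div_le_div_of_nonneg_right (show (1 / 4 : ℝ) ≤ 861 by norm_num) (by positivity))
  · have h := dev_one_one L hL
    push_cast at h ⊢
    exact h.trans (div_le_div_of_nonneg_right (show (1 : ℝ) ≤ 861 by norm_num) (by positivity))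
  · have h := dev_two_zero L hL
    push_cast at h ⊢
    exact h.trans (div_le_div_of_nonneg_right (show (4 : ℝ) ≤ 861 by norm_num) (by positivity))
  · have h := dev_two_one L hL
    push_cast at h ⊢
    exact h.trans (div_le_div_of_nonneg_right (show (3 : ℝ) ≤ 861 by norm_num) (by positivity))
  · have h := dev_two_two L hL
    push_cast at h ⊢
    exact h.trans (div_le_div_of_nonneg_right (show (4 : ℝ) ≤ 861 by norm_num) (by positivity))
  · have h := dev_three_zero L hL
    push_cast at h ⊢
    exact h.trans (div_le_div_of_nonneg_right (show (24 : ℝ) ≤ 861 by norm_num) (by positivity))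
  · have h := dev_three_one L hL
    push_cast at h ⊢
    exact h.trans (div_le_div_of_nonneg_right (show (22 : ℝ) ≤ 861 by norm_num) (by positivity))
  · have h := dev_three_two L hL
    push_cast at h ⊢
    exact h.trans (div_le_div_of_nonneg_right (show (12 : ℝ) ≤ 861 by norm_num) (by positivity))
  · have h := dev_three_three L hL
    push_cast at h ⊢
    exact h.trans (div_le_div_of_nonneg_right (show (9 : ℝ) ≤ 861 by norm_num) (by positivity))
  · have h := dev_four_zero L hL
    push_cast at h ⊢
    exact h.trans (div_le_div_of_nonneg_right (show (145 : ℝ) ≤ 861 by norm_num) (by positivity))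
  · have h := dev_four_one L hL
    push_cast at h ⊢
    exact h.trans (div_le_div_of_nonneg_right (show (128 : ℝ) ≤ 861 by norm_num) (by positivity))
  · have h := dev_four_two L hL
    push_cast at h ⊢
    exact h.trans (div_le_div_of_nonneg_right (show (84 : ℝ) ≤ 861 by norm_num) (by positivity))
  · have h := dev_four_three L hL
    push_cast at h ⊢
    exact h.trans (div_le_div_of_nonneg_right (show (31 : ℝ) ≤ 861 by norm_num) (by positivity))
  · have h := dev_four_four L hL
    push_cast at h ⊢
    exact h.trans (div_le_div_of_nonneg_right (show (16 : ℝ) ≤ 861 by norm_num) (by positivity))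
  · have h := dev_five_zero L hL
    push_cast at h ⊢
    exact h.trans (div_le_div_of_nonneg_right (show (861 : ℝ) ≤ 861 by norm_num) (by positivity))
  · have h := dev_five_one L hL
    push_cast at h ⊢
    exact h.trans (div_le_div_of_nonneg_right (show (764 : ℝ) ≤ 861 by norm_num) (by positivity))
  · have h := dev_five_two L hL
    push_cast at h ⊢
    exact h.trans (div_le_div_of_nonneg_right (show (508 : ℝ) ≤ 861 by norm_num) (by positivity))
  · have h := dev_five_three L hL
    push_cast at h ⊢
    exact h.trans (div_le_div_of_nonneg_right (show (234 : ℝ) ≤ 861 by norm_num) (by positivity))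
  · have h := dev_five_four L hL
    push_cast at h ⊢
    exact h.trans (div_le_div_of_nonneg_right (show (64 : ℝ) ≤ 861 by norm_num) (by positivity))
  · have h := dev_five_five L hL
    push_cast at h ⊢
    exact h.trans (div_le_div_of_nonneg_right (show (25 : ℝ) ≤ 861 by norm_num) (by positivity))

/-- ★ **THE WINDOW PERIODISATION BOUND:** `|a_L(v;0) − a_∞(v)| ≤ 861/L²` for every integer vector with `|v₁|, |v₂| ≤ 5` (`L ≥ 12`). [folklore] -/
theorem abs_aKer_sub_aZ2_window (hL : 12 ≤ L) (a b : ℤ) (ha : |a| ≤ 5) (hb : |b| ≤ 5) :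
    |aKer L 0 (((a : ℤ) : ZMod L), ((b : ℤ) : ZMod L)) - aZ2 a b| ≤ 861 / (L : ℝ) ^ 2 := by
  -- nonnegative coordinates
  have key : ∀ a b : ℤ, 0 ≤ a → 0 ≤ b → a ≤ 5 → b ≤ 5 →
      |aKer L 0 (((a : ℤ) : ZMod L), ((b : ℤ) : ZMod L)) - aZ2 a b| ≤ 861 / (L : ℝ) ^ 2 := by
    intro a b ha0 hb0 ha5 hb5
    obtain ⟨x, rfl⟩ := Int.eq_ofNat_of_zero_le ha0
    obtain ⟨y, rfl⟩ := Int.eq_ofNat_of_zero_le hb0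
    rcases le_total y x with hyx | hxy
    · exact window_canon L hL x y hyx (by omega)
    · rw [aKer_int_swap L 0 (y : ℤ) (x : ℤ), aZ2_swap (y : ℤ) (x : ℤ)]
      exact window_canon L hL y x hxy (by omega)
  -- signs
  have hxa : |aKer L 0 (((a : ℤ) : ZMod L), ((b : ℤ) : ZMod L)) - aZ2 a b|
      = |aKer L 0 ((((|a| : ℤ)) : ZMod L), ((b : ℤ) : ZMod L)) - aZ2 (|a|) b| := by
    rcases abs_choice a with h | h
    · rw [h]
    · rw [h, aKer_int_mirror_x L 0 a b, aZ2_mirror a b]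
  have hyb : |aKer L 0 ((((|a| : ℤ)) : ZMod L), ((b : ℤ) : ZMod L)) - aZ2 (|a|) b|
      = |aKer L 0 ((((|a| : ℤ)) : ZMod L), (((|b| : ℤ)) : ZMod L)) - aZ2 (|a|) (|b|)| := by
    rcases abs_choice b with h | h
    · rw [h]
    · rw [h, aKer_int_mirror_y L 0 (|a|) b, aZ2_mirror_y (|a|) b]
  rw [hxa, hyb]
  exact key (|a|) (|b|) (abs_nonneg a) (abs_nonneg b) ha hb

end Subsample

namespace TwoHoleBS

variable (L : ℕ) [NeZero L]

/-- ★★★ **NEAR-PAIR TAIL CERTIFICATE, SHARP INPUTS** (`12 ≤ L`, `|d₁|, |d₂| ≤ 3`): `DualCert L (¾ε₁) z (z + d)` from invertibility of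
`skelA d`, a capacity parameter `Λup ≥ H_{⌊L/2⌋}/π + 1.52` with `Λup·s ≠ 1`, and the margin inequality with the error coefficient
`ε♯(L,d) = 2ρmax(11.71 ln L + 5.9)/L² + 1722/L²`. [folklore] -/
theorem dualCert_threeQuarter_near_window (hL : 12 ≤ L) (z : Tor L) (d : ℤ × ℤ) (hd1 : |d.1| ≤ 3) (hd2 : |d.2| ≤ 3) (Λup : ℝ)
    (hA : IsUnit (skelA d).det)
    (hcap : (harmonic (L / 2) : ℝ) / Real.pi + 152 / 100 ≤ Λup) (hΛ : Λup * TwoChannel.svec2 (skelA d) - 1 ≠ 0)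
    (hpos : ∀ w : Fin 4 ⊕ Fin 4 → ℝ,
      (2 * (rhoMax d * (11.71 * Real.log L + 5.9) / (L : ℝ) ^ 2) + 1722 / (L : ℝ) ^ 2)
        * (∑ p : Fin 5 ⊕ Fin 5, |(smInv (skelA d) Λup).mulVec (pad w) p|) ^ 2
        ≤ dotProduct w ((TwoChannel.twoHoleP (skelA d) Λup).mulVec w)) :
    DualCert L (3 / 4 * eps1 L) z (z + castPt L d) := by
  have hL1 : (1 : ℝ) ≤ L := by exact_mod_cast (show 1 ≤ L by omega)
  have hLpos : (0 : ℝ) < L := by linarith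
  have he := RateLemma.eps1_pos_of_two_le L (by omega)
  have hlog : 0 ≤ 11.71 * Real.log L + 5.9 := by
    have := Real.log_nonneg hL1
    positivity
  have hcapT : capT L (3 / 4 * eps1 L) ≤ Λup := by
    unfold capT
    exact (two_Gres_lamH_zero_le_sharp L (by omega)).trans hcap
  refine dualCert_of_skeleton_capUpper L (3 / 4 * eps1 L) z (z + castPt L d) (skelA d) (skelA_isSymm d) hA Λup hΛ hcapT
    (2 * (rhoMax d * (11.71 * Real.log L + 5.9) / (L : ℝ) ^ 2) + 1722 / (L : ℝ) ^ 2) (fun p q => ?_) hpos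
  have h := kerMat_sub_model_le L (by omega) (g := 3 / 4 * eps1 L) (by positivity) (by linarith) z (z + castPt L d) (skelA d) p q
  refine h.trans (add_le_add ?_ ?_)
  · -- the shell bound, `shellMajorant_holds` at `λ = 2g = (3/2)ε₁`
    rw [bsPt_sub_eq_castPt]
    unfold castPt
    have h := RateLemma.shellMajorant_holds L (by omega) (2 * (3 / 4 * eps1 L)) (by positivity) (by linarith)
      (ipt d p - ipt d q).1 (ipt d p - ipt d q).2
    have h2 := mul_le_mul_of_nonneg_left h (show (0 : ℝ) ≤ 2 by norm_num)
    refine h2.trans ?_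
    rw [mul_div_assoc, mul_div_assoc]
    exact mul_le_mul_of_nonneg_left (mul_le_mul_of_nonneg_right (normSq_ipt_sub_le d p q) (by positivity)) (by norm_num)
  · -- the periodisation bound on the window, `abs_aKer_sub_aZ2_window`
    rw [bsPt_sub_eq_castPt]
    simp only [skelA, Matrix.of_apply]
    unfold castPt
    obtain ⟨hb1, hb2⟩ := ipt_sub_bound d p q
    have h := Subsample.abs_aKer_sub_aZ2_window L hL (ipt d p - ipt d q).1 (ipt d p - ipt d q).2 (by linarith) (by linarith)
    rw [← mul_sub, abs_mul, abs_two]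
    calc 2 * |aKer L 0 ((((ipt d p - ipt d q).1 : ℤ) : ZMod L), (((ipt d p - ipt d q).2 : ℤ) : ZMod L))
          - Subsample.aZ2 (ipt d p - ipt d q).1 (ipt d p - ipt d q).2| ≤ 2 * (861 / (L : ℝ) ^ 2) := by gcongr
      _ = 1722 / (L : ℝ) ^ 2 := by ring

end TwoHoleBS

end Summit.HubbardSuperconductivity.HubbardSuperconductivity.Theorems.AnisotropyChord.Transfer.Fibre3

end
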